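import Summits.Ventures.CertifiedManyBodySolver.Rows.HalfFilledTLTorus
import Summits.Ventures.CertifiedManyBodySolver.Rows.HalfFilledTLFreeControl

/-!
# M2 rows, part 17 — FREE-CONTROL PROPAGATION through the TL row vocabulary: the kinetic free floor, `k` monotone in `U`, and the concavity SECANT with the theorem free floor as its `U' = 0` node

HONEST FRAMING: first certified bounds; not a superconductivity verdict; every number certified or
labelled float.  This file adds NO certified number and imports NO certificate.  It is the tree home of the
solver-free corollaries staged (lean-checked, never proposed) by the M2 IMPORT seat `pub-mbboot-adv-2` in
`FreeControlPropagation.lean` §1–§2 (companion of `m2/SECANT-CARD.md`), NAMES KEPT; the by-name instances of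
its §3 over CERTIFIED.md claim nodes are part 18 (`Rows/HalfFilledTLCertJoins3.lean`), by the standing rule that
vocabulary files never import `Certificates/`.

Everything below is the supergradient inequality of the concave map `U ↦ e₀(U)`
(`IsTorusLimitOf.energyDensity2D_sub_le_mul_re_expect_docc_halfFilled`: `e₀(U') ≤ e₀(U) + (U' − U)·d_ω` for
`ω ∈ TLGS(U)`), read through `k_ω = e₀(U) − U·d_ω` (`IsTLGS.kinetic_eq`, part 4) and part 13's certificate-free
floor `-1.6212 ≤ e₀(U')` at `U' = 0` (`m2EnergyLowerRow_free`):

* §1 `kinetic_ge_free` — the KINETIC FREE FLOOR on TLGS(U), `U ≥ 0`: `-1.6212 ≤ Re ω(k₀)` (indeed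
  `k_ω ≥ e₀(0) = -16/π²`); `KineticRow.inter_free` clips any kinetic row's floor at `-1.6212`;
  `kinetic_mono` — `k` is NON-DECREASING in `U` across TLGS classes (`0 ≤ U₁ < U₂`), from the supergradient
  inequality at `U₂` and `docc_anti` (part 1); `KineticRow.lower_transport` / `KineticRow.inter_transport` —
  a kinetic FLOOR proved at `U₁ > 0` is a kinetic floor at every `U₂ > U₁` (TLGS(U₁) is nonempty, Lieb).
* §2 `CorrelatorRow.mono` (endpoint weakening); `DoccRow.of_rows_free` — two energy rows (an upper at `U`, a
  lower at `U'' > U`) and the free floor give a two-sided TL docc row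
  `d(U) ∈ [(lo'' − hi)/(U'' − U), (hi + 1.6212)/U]` (`DoccRow.of_energyRows` with `U' = 0`);
  `docc_le_secant` — a lower at `U' < U` and an upper at `U` give the one-sided ceiling `(hi − lo')/(U − U')`
  on TLGS(U); `docc_le_free_secant` — the free case `(hi + 1.6212)/U`.

READING RULE (binding, as parts 11 / 13 / 14): these are THEOREM edges; a table endpoint obtained through them
from certified energy rows is a `corollary (certified + theorem)` — hypothesis-grade in the claim nodes it
consumes, never itself "certified", never in an M2-width verdict or the tightest-visible pool; as PIPELINE
CONTROLS (m2-5 `derived_controls`, report-only) a certified kinetic floor below `-1.6212`, a certified docc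
ceiling above the free secant, or a certified kinetic floor at `U₂` below a certified kinetic floor at
`U₁ < U₂` is merely LOOSE (implied by a theorem edge), while an endpoint on the wrong side of an edge is a
CONTRADICTION.
-/

noncomputable section

namespace Summit.Ventures.CertifiedManyBodySolver

open Literature.MathematicalPhysics.QuantumLattice
open Matrix HubbardWave0 Literature.Probability.LatticeModels FermionSpinMoment ThermodynamicLimit Filter Topology
open Summit.HubbardSuperconductivity.ManyBodyBootstrap.Bounds (nnSupport)
open scoped ComplexOrder BigOperators

namespace M2

/-! ## §1 Kinetic free floor, monotonicity and transport on TLGS -/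

/-- **Kinetic free floor on TLGS(U)** (`U ≥ 0`): `-1.6212 ≤ Re ω(k₀)`; indeed `k_ω = e₀(U) − U·d_ω ≥ e₀(0)
= -16/π² > -1.6212` (supergradient inequality at `U' = 0` + the free floor, part 13). [cite: KomaTasaki1994, §1]
[cite: Hirsch1985, §II, eq. (2.2)] -/
theorem kinetic_ge_free {U : ℝ} (hU : 0 ≤ U) {ω : InfVolFermionState 2} (hω : IsTLGS U ω) :
    (((-1.6212 : ℚ)) : ℝ) ≤ (ω.expect nnSupport (kineticWords (-1))).re := by
  rw [hω.kinetic_eq hU]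
  obtain ⟨Ls, ψ, hLs, hev, hψ, hn, hω'⟩ := hω
  have hA := hω'.energyDensity2D_sub_le_mul_re_expect_docc_halfFilled hLs hev 1 hU le_rfl hψ hn
  have hfree : (((-1.6212 : ℚ)) : ℝ) ≤ energyDensity2D 1 0 1 := m2EnergyLowerRow_free le_rfl
  unfold doccAt0
  rw [zero_sub, neg_mul] at hA
  linarith

/-- A kinetic row's floor may be clipped at the free floor: `KineticRow U lo hi → KineticRow U (max lo (-1.6212)) hi`
(`U ≥ 0`). [cite: KomaTasaki1994, §1] -/
theorem KineticRow.inter_free {U : ℝ} (hU : 0 ≤ U) {lo hi : ℚ} (h : KineticRow U lo hi) :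
    KineticRow U (max lo (-1.6212)) hi := by
  intro ω hω
  obtain ⟨h1, h2⟩ := h ω hω
  refine ⟨?_, h2⟩
  have hf := kinetic_ge_free hU hω
  rw [Rat.cast_max]
  exact max_le h1 hf

/-- The free floor as a kinetic row with the trivial ceiling `0 ≤ hi`? No ceiling is claimed: the one-sided
reading is `kinetic_ge_free`; as a ROW the free floor joins any kinetic ceiling row: `KineticRow U lo hi →
KineticRow U (-1.6212) hi`. [cite: KomaTasaki1994, §1] -/
theorem KineticRow.free_floor {U : ℝ} (hU : 0 ≤ U) {lo hi : ℚ} (h : KineticRow U lo hi) :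
    KineticRow U (-1.6212) hi :=
  fun ω hω => ⟨kinetic_ge_free hU hω, (h ω hω).2⟩

/-- **`k` is non-decreasing in `U` on TLGS** (`0 ≤ U₁ < U₂`): `k(ω₁) ≤ k(ω₂)` for `ω₁ ∈ TLGS(U₁)`,
`ω₂ ∈ TLGS(U₂)`, from `e₀(U₁) ≤ e₀(U₂) + (U₁ − U₂)·d(ω₂)` (supergradient at `U₂`) and `d(ω₂) ≤ d(ω₁)`
(`docc_anti`). [cite: KomaTasaki1994, §1] -/
theorem kinetic_mono {U₁ U₂ : ℝ} (hU₁ : 0 ≤ U₁) (hU : U₁ < U₂) {ω₁ ω₂ : InfVolFermionState 2}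
    (h₁ : IsTLGS U₁ ω₁) (h₂ : IsTLGS U₂ ω₂) :
    (ω₁.expect nnSupport (kineticWords (-1))).re ≤ (ω₂.expect nnSupport (kineticWords (-1))).re := by
  have hU₂ : 0 ≤ U₂ := hU₁.trans hU.le
  have hd := docc_anti hU₁ hU h₁ h₂
  rw [h₁.kinetic_eq hU₁, h₂.kinetic_eq hU₂]
  obtain ⟨Ls, ψ, hLs, hev, hψ, hn, hω'⟩ := h₂
  have hA := hω'.energyDensity2D_sub_le_mul_re_expect_docc_halfFilled hLs hev 1 hU₂ hU₁ hψ hn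
  unfold doccAt0 at hd ⊢
  have hP := mul_le_mul_of_nonneg_left hd hU₁
  nlinarith [hP, hA]

/-- **Transport of a kinetic FLOOR up in `U`**: a kinetic row at `U₁ > 0` gives its floor on all of TLGS(U₂)
for every `U₂ > U₁` (TLGS(U₁) is nonempty — Lieb's ground state on every even torus + Banach–Alaoglu,
`IsTLGS.nonempty` — and `kinetic_mono`). [cite: KomaTasaki1994, §1] [cite: LiebPRL1989, Theorem 2] -/
theorem KineticRow.lower_transport {U₁ U₂ : ℝ} (hU₁ : 0 < U₁) (hU : U₁ < U₂) {lo hi : ℚ}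
    (h : KineticRow U₁ lo hi) :
    ∀ ω : InfVolFermionState 2, IsTLGS U₂ ω → ((lo : ℚ) : ℝ) ≤ (ω.expect nnSupport (kineticWords (-1))).re := by
  intro ω hω
  obtain ⟨ω₁, h₁⟩ := IsTLGS.nonempty hU₁
  exact (h ω₁ h₁).1.trans (kinetic_mono hU₁.le hU h₁ hω)

/-- **Row form of the transport**: kinetic rows at `0 < U₁ < U₂` give `KineticRow U₂ (max lo₁ lo₂) hi₂`.
[cite: KomaTasaki1994, §1] [cite: LiebPRL1989, Theorem 2] -/
theorem KineticRow.inter_transport {U₁ U₂ : ℝ} (hU₁ : 0 < U₁) (hU : U₁ < U₂) {lo₁ hi₁ lo₂ hi₂ : ℚ}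
    (h₁ : KineticRow U₁ lo₁ hi₁) (h₂ : KineticRow U₂ lo₂ hi₂) : KineticRow U₂ (max lo₁ lo₂) hi₂ := by
  intro ω hω
  refine ⟨?_, (h₂ ω hω).2⟩
  rw [Rat.cast_max]
  exact max_le (h₁.lower_transport hU₁ hU ω hω) (h₂ ω hω).1

/-! ## §2 The concavity secant with the free floor as the `U' = 0` node -/

/-- Weakening of a correlator row's rational endpoints. [cite: BratteliRobinsonII1997, §6.2.4] -/
theorem CorrelatorRow.mono {U : ℝ} {Λ : Finset (Site 2)} {X : FermionOp Λ} {lo lo' hi hi' : ℚ}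
    (hlo : lo' ≤ lo) (hhi : hi ≤ hi') (h : CorrelatorRow U Λ X lo hi) : CorrelatorRow U Λ X lo' hi' :=
  fun ω hω => ⟨le_trans (by exact_mod_cast hlo) (h ω hω).1, (h ω hω).2.trans (by exact_mod_cast hhi)⟩

/-- **Two energy rows + the free floor ⇒ a TL docc row** (`0 < U < U''`): the upper `e₀(U) ≤ hi` and the
lower `lo'' ≤ e₀(U'')` give `d(U) ∈ [(lo'' − hi)/(U'' − U), (hi + 1.6212)/U]`
(`DoccRow.of_energyRows` with `U' = 0`, `lo' = -1.6212` = `m2EnergyLowerRow_free`). [cite: KomaTasaki1994, §1] -/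
theorem DoccRow.of_rows_free {U U'' : ℚ} (h1 : 0 < U) (h2 : U < U'') {hi lo'' : ℚ}
    (hhi : M2EnergyUpperRow U hi) (hlo'' : M2EnergyLowerRow U'' lo'') :
    DoccRow U ((lo'' - hi) / (U'' - U)) ((hi - (-1.6212)) / (U - 0)) := by
  have h0 : M2EnergyLowerRow ((0 : ℚ) : ℝ) (-1.6212 : ℚ) := m2EnergyLowerRow_free (by simp)
  exact DoccRow.of_energyRows le_rfl h1 h2 h0 hhi hlo''

/-- **Secant docc CEILING from two energy rows** (`0 ≤ U' < U`): `lo' ≤ e₀(U')` and `e₀(U) ≤ hi` give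
`Re ω(n↑n↓) ≤ (hi − lo')/(U − U')` on TLGS(U) (supergradient inequality at `U'`). [cite: KomaTasaki1994, §1] -/
theorem docc_le_secant {U' U : ℚ} (hU' : 0 ≤ U') (hU : U' < U) {lo' hi : ℚ}
    (hlo' : M2EnergyLowerRow U' lo') (hhi : M2EnergyUpperRow U hi) :
    ∀ ω : InfVolFermionState 2, IsTLGS U ω →
      (ω.expect ({0} : Finset (Site 2)) (doccAt0 2)).re ≤ (((hi - lo') / (U - U') : ℚ) : ℝ) := by
  intro ω hω
  obtain ⟨Ls, ψ, hLs, hev, hψ, hn, hω'⟩ := hω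
  have hU'r : (0 : ℝ) ≤ (U' : ℝ) := by exact_mod_cast hU'
  have hUr : ((U' : ℚ) : ℝ) < U := by exact_mod_cast hU
  have hB := hω'.energyDensity2D_sub_le_mul_re_expect_docc_halfFilled hLs hev 1 (hU'r.trans hUr.le) hU'r hψ hn
  have hlo'' : ((lo' : ℚ) : ℝ) ≤ energyDensity2D 1 U' 1 := hlo'
  have hhi' : energyDensity2D 1 U 1 ≤ ((hi : ℚ) : ℝ) := hhi
  unfold doccAt0
  push_cast
  rw [le_div_iff₀ (sub_pos.2 hUr)]
  nlinarith [hB, hlo'', hhi']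

/-- **One energy upper ⇒ the free-secant docc CEILING** `Re ω(n↑n↓) ≤ (hi + 1.6212)/U` on TLGS(U), `U > 0`
(`docc_le_secant` with the theorem free floor as the `U' = 0` node). [cite: KomaTasaki1994, §1] -/
theorem docc_le_free_secant {U : ℚ} (hU : 0 < U) {hi : ℚ} (hhi : M2EnergyUpperRow U hi) :
    ∀ ω : InfVolFermionState 2, IsTLGS U ω →
      (ω.expect ({0} : Finset (Site 2)) (doccAt0 2)).re ≤ (((hi - (-1.6212)) / (U - 0) : ℚ) : ℝ) :=
  docc_le_secant le_rfl hU (m2EnergyLowerRow_free (by simp)) hhi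

/-- **Certificate-shaped form of the free-secant ceiling**: for every energy-premise slot `u` and every
`U > 0`, `M2DoccUpperRow U u ((u + 1.6212)/U)` holds outright (the node's own premise `e₀(U) ≤ u` is the upper
row the secant needs) — so a certified `…_Dup` node at premise `u` whose `q` exceeds `(u + 1.6212)/U` is LOOSE
(implied by a theorem), never a contradiction. [cite: KomaTasaki1994, §1] -/
theorem m2DoccUpperRow_free_secant {U : ℚ} (hU : 0 < U) (u : ℚ) :
    M2DoccUpperRow U u ((u - (-1.6212)) / (U - 0)) := by
  intro ω Ls ψ hLs hev hψ hn hω hE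
  exact docc_le_free_secant hU hE ω ⟨Ls, ψ, hLs, hev, hψ, hn, hω⟩

end M2

end Summit.Ventures.CertifiedManyBodySolver
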